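import Literature.AlgebraicGeometry.Motives.MumfordTateInvariantsDerivation
import HarnessLib

/-!
# The derivation action is a Lie-algebra action: brackets, conjugation, and the "exponential" gadget (Zarhin's theorem, step 1)

Generic linear algebra over a field `K` for the derivation action
`ρ(X) = tensorDerivation a b X` of `X ∈ End_K(W)` on the tensor spaces
`T^{a,b}_K W = W^{⊗a} ⊗ (W^∨)^{⊗b}` (`MumfordTateInvariantsDerivation.lean`) and the group action
`tensorSpaceActOver g` of `g ∈ GL(W)` (`EtaleTate.lean`):

* `piTensorDerivation_commutator`, `tensorDerivation_commutator`: `ρ` is a Lie algebra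
  homomorphism, `ρ(XY - YX) = ρ(X)ρ(Y) - ρ(Y)ρ(X)` — so the annihilator `{X | ρ(X) s = 0}` of any
  family of tensors is a Lie subalgebra of `𝔤𝔩(W)` (`tensorDerivation_commutator_apply_eq_zero`);
* `tensorDerivation_conj_comp`: `ρ` is equivariant for conjugation,
  `ρ(g X g⁻¹) ∘ (g·) = (g·) ∘ ρ(X)` — so the annihilator of a family of tensors fixed by `g` is
  stable under `Ad(g)` (`tensorDerivation_conj_apply_eq_zero`);
* `tensorSpaceActOver_eq_self_of_tensorDerivation_eq_zero` (the **exponential gadget**): if `k ∈ GL(W)`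
  and `Y ∈ End(W)` are diagonal in a common basis with eigenvalues `u` and `y` such that every
  additive relation `Σ y(βₖ) - Σ y(γₗ) = 0` among the `y` forces the multiplicative relation
  `∏ u(βₖ) (∏ u(γₗ))⁻¹ = 1` (e.g. `u = exp ∘ y`), then every tensor killed by `ρ(Y)` is fixed by `k`.

These are the Lie-theoretic inputs (Borel, *Linear Algebra Groups*, §3.9 and §7: the differential
of the tensor representation, `Ad`-equivariance, and "a torus fixes what its Lie algebra kills")
of the tree's elementary proof of Zarhin's theorem on the Hodge group of a Hodge structure of K3
type (Huybrechts, *Lectures on K3 Surfaces*, Thm. 3.3.9; Zarhin 1983, Thm. 2.2.1), where the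
algebraic group is replaced by the annihilator Lie algebra of the Hodge tensors. Nothing here is
specific to Hodge theory; no definitions and no named facts are introduced.

## References

* A. Borel, *Linear Algebraic Groups*, 2nd ed., GTM 126 (1991), §3.9, §7.3.
* P. Deligne, *Hodge cycles on abelian varieties*, LNM 900 (1982), I §3.1.
-/

noncomputable section

open scoped TensorProduct PiTensorProduct

namespace Literature.AlgebraicGeometry.Motives

universe u v w

variable {K : Type u} [Field K] {W : Type v} [AddCommGroup W] [Module K W]

/-! ### The derivation action is a Lie algebra homomorphism -/

/-- On the tensor power: `D_a(XY - YX) = D_a(X) D_a(Y) - D_a(Y) D_a(X)` (slots commute pairwise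
and each slot embedding is an algebra homomorphism). [folklore] -/
theorem piTensorDerivation_commutator (a : ℕ) (X Y : Module.End K W) :
    piTensorDerivation a (X * Y - Y * X) =
      piTensorDerivation a X * piTensorDerivation a Y -
        piTensorDerivation a Y * piTensorDerivation a X := by
  have key : ∀ k l : Fin a, k ≠ l →
      piTensorSlot a k X * piTensorSlot a l Y = piTensorSlot a l Y * piTensorSlot a k X :=
    fun k l hkl => (commute_piTensorSlot a hkl X Y).eq
  rw [map_sub, piTensorDerivation_apply, piTensorDerivation_apply, piTensorDerivation_apply,
    piTensorDerivation_apply, Finset.sum_mul_sum, Finset.sum_mul_sum,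
    Finset.sum_comm (f := fun l k => piTensorSlot a l Y * piTensorSlot a k X),
    ← Finset.sum_sub_distrib, ← Finset.sum_sub_distrib]
  refine Finset.sum_congr rfl fun k _ => ?_
  rw [← Finset.sum_sub_distrib, Finset.sum_eq_single k, map_mul, map_mul]
  · intro l _ hlk
    rw [key k l (Ne.symm hlk), sub_self]
  · intro hk
    exact absurd (Finset.mem_univ k) hk

/-- Transposition is an anti-homomorphism: `(XY)^∨ = Y^∨ X^∨`. [folklore] -/
theorem dualMap_mul' (X Y : Module.End K W) :
    (X * Y).dualMap = (Y.dualMap : Module.End K (Module.Dual K W)) * X.dualMap := by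
  rw [Module.End.mul_eq_comp, Module.End.mul_eq_comp, ← LinearMap.dualMap_comp_dualMap]

/-- Additive form of the commutator rule after `1 ⊗ -`, generic in `W` and in a module `M` that
is only known to be a monoid: `1 ⊗ D(XY - YX) + (1 ⊗ D Y)(1 ⊗ D X) = (1 ⊗ D X)(1 ⊗ D Y)` (used with
`W` a dual space, where the subtraction of endomorphisms of the tensor power is not available by
instance search). [folklore] -/
theorem lTensor_piTensorDerivation_commutator_add (M : Type w) [AddCommMonoid M] [Module K M]
    (a : ℕ) (X Y : Module.End K W) :
    (piTensorDerivation a (X * Y - Y * X)).lTensor M +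
        (piTensorDerivation a Y).lTensor M * (piTensorDerivation a X).lTensor M =
      (piTensorDerivation a X).lTensor M * (piTensorDerivation a Y).lTensor M := by
  rw [piTensorDerivation_commutator, ← LinearMap.lTensor_mul, ← LinearMap.lTensor_mul,
    ← LinearMap.lTensor_add, sub_add_cancel]

/-- **The derivation action `ρ = tensorDerivation a b` is a Lie algebra homomorphism**
`𝔤𝔩(W) → 𝔤𝔩(T^{a,b}_K W)`: `ρ(XY - YX) = ρ(X) ρ(Y) - ρ(Y) ρ(X)` (the differential of the
representation `g ↦ g^{⊗a} ⊗ (g⁻¹)^{∨⊗b}`; Borel, *Linear Algebraic Groups*, §3.9). [folklore] -/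
theorem tensorDerivation_commutator (a b : ℕ) (X Y : Module.End K W) :
    tensorDerivation a b (X * Y - Y * X) =
      tensorDerivation a b X * tensorDerivation a b Y -
        tensorDerivation a b Y * tensorDerivation a b X := by
  -- cross terms commute: `(A ⊗ 1)(1 ⊗ B) = (1 ⊗ B)(A ⊗ 1)`
  have hcross : ∀ (f : Module.End K (⨂[K]^a W)) (g : Module.End K (⨂[K]^b (Module.Dual K W))),
      f.rTensor (⨂[K]^b (Module.Dual K W)) * g.lTensor (⨂[K]^a W) =
        g.lTensor (⨂[K]^a W) * f.rTensor (⨂[K]^b (Module.Dual K W)) := fun f g => by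
    rw [Module.End.mul_eq_comp, Module.End.mul_eq_comp, LinearMap.rTensor_comp_lTensor,
      LinearMap.lTensor_comp_rTensor]
  have hdual : (X * Y - Y * X).dualMap =
      (Y.dualMap : Module.End K (Module.Dual K W)) * X.dualMap - X.dualMap * Y.dualMap := by
    rw [LinearMap.dualMap_def, map_sub]
    change (X * Y).dualMap - (Y * X).dualMap = _
    rw [dualMap_mul', dualMap_mul']
  -- `f ↦ f ⊗ 1` is an algebra homomorphism
  have hr : (piTensorDerivation a (X * Y - Y * X)).rTensor (⨂[K]^b (Module.Dual K W)) =
      (piTensorDerivation a X).rTensor _ * (piTensorDerivation a Y).rTensor _ -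
        (piTensorDerivation a Y).rTensor _ * (piTensorDerivation a X).rTensor _ := by
    have := map_sub (Module.End.rTensorAlgHom K (⨂[K]^a W) (⨂[K]^b (Module.Dual K W)))
      (piTensorDerivation a X * piTensorDerivation a Y)
      (piTensorDerivation a Y * piTensorDerivation a X)
    rw [map_mul, map_mul, ← piTensorDerivation_commutator] at this
    exact this
  -- `g ↦ 1 ⊗ g` on the dual side, through the additive form
  have hl : (piTensorDerivation b (LinearMap.dualMap (X * Y - Y * X))).lTensor (⨂[K]^a W) =
      (piTensorDerivation b (LinearMap.dualMap Y)).lTensor _ *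
          (piTensorDerivation b (LinearMap.dualMap X)).lTensor _ -
        (piTensorDerivation b (LinearMap.dualMap X)).lTensor _ *
          (piTensorDerivation b (LinearMap.dualMap Y)).lTensor _ := by
    rw [hdual]
    exact eq_sub_of_add_eq (G := Module.End K (hodgeTensorSpaceOver K W a b))
      (lTensor_piTensorDerivation_commutator_add (⨂[K]^a W) b
        (LinearMap.dualMap Y) (LinearMap.dualMap X))
  rw [tensorDerivation_apply, tensorDerivation_apply, tensorDerivation_apply, hr, hl]
  set r₁ := (piTensorDerivation a X).rTensor (⨂[K]^b (Module.Dual K W))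
  set r₂ := (piTensorDerivation a Y).rTensor (⨂[K]^b (Module.Dual K W))
  set l₁ := (piTensorDerivation b (LinearMap.dualMap X)).lTensor (⨂[K]^a W)
  set l₂ := (piTensorDerivation b (LinearMap.dualMap Y)).lTensor (⨂[K]^a W)
  have h12 : ∀ s, r₁ (l₂ s) = l₂ (r₁ s) := fun s => LinearMap.congr_fun (hcross _ _) s
  have h21 : ∀ s, r₂ (l₁ s) = l₁ (r₂ s) := fun s => LinearMap.congr_fun (hcross _ _) s
  refine LinearMap.ext fun s => ?_
  simp only [LinearMap.sub_apply, Module.End.mul_apply, map_sub, h12, h21]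
  abel

/-- The annihilator of a tensor is closed under commutators: if `ρ(X) s = 0` and `ρ(Y) s = 0`
then `ρ(XY - YX) s = 0`. [folklore] -/
theorem tensorDerivation_commutator_apply_eq_zero {a b : ℕ} {X Y : Module.End K W}
    {s : hodgeTensorSpaceOver K W a b} (hX : tensorDerivation a b X s = 0)
    (hY : tensorDerivation a b Y s = 0) : tensorDerivation a b (X * Y - Y * X) s = 0 := by
  rw [tensorDerivation_commutator, LinearMap.sub_apply, Module.End.mul_apply,
    Module.End.mul_apply, hX, hY, map_zero, map_zero, sub_zero]

/-! ### Equivariance under conjugation -/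

/-- Conjugating an endomorphism diagonalwise: `(g X g⁻¹) (g w) = g (X w)`. [folklore] -/
theorem conj_comp_apply (g : W ≃ₗ[K] W) (X : Module.End K W) (w : W) :
    ((g : W →ₗ[K] W) ∘ₗ X ∘ₗ (g.symm : W →ₗ[K] W)) (g w) = g (X w) := by
  simp

/-- **`Ad`-equivariance of the derivation action**: `ρ(g X g⁻¹) ∘ (g·) = (g·) ∘ ρ(X)` on
`T^{a,b}_K W`, where `g·` is `tensorSpaceActOver g` (Borel, *Linear Algebraic Groups*, §3.9:
the differential of the tensor representation intertwines `Ad`). [folklore] -/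
theorem tensorDerivation_conj_comp {a b : ℕ} (g : W ≃ₗ[K] W) (X : Module.End K W) :
    tensorDerivation a b ((g : W →ₗ[K] W) ∘ₗ X ∘ₗ (g.symm : W →ₗ[K] W)) ∘ₗ
        (tensorSpaceActOver (a := a) (b := b) g).toLinearMap =
      (tensorSpaceActOver (a := a) (b := b) g).toLinearMap ∘ₗ tensorDerivation a b X := by
  have hdual : ∀ (φ : Module.Dual K W),
      (φ ∘ₗ (g.symm : W →ₗ[K] W)) ∘ₗ ((g : W →ₗ[K] W) ∘ₗ X ∘ₗ (g.symm : W →ₗ[K] W)) =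
        (φ ∘ₗ X) ∘ₗ (g.symm : W →ₗ[K] W) := fun φ => by
    ext w
    simp
  ext v φ
  simp only [LinearMap.compMultilinearMap_apply, LinearMap.coe_comp, Function.comp_apply,
    TensorProduct.AlgebraTensorModule.curry_apply, TensorProduct.curry_apply,
    LinearMap.coe_restrictScalars, LinearEquiv.coe_coe, tensorSpaceActOver_tmul_tprod,
    tensorDerivation_tmul_tprod, map_sub, map_sum, TensorProduct.sum_tmul,
    TensorProduct.tmul_sum]
  congr 1
  · refine Finset.sum_congr rfl fun k _ => ?_
    congr 2
    funext i
    by_cases hi : i = k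
    · subst hi
      simp
    · simp [Function.update_of_ne hi]
  · refine Finset.sum_congr rfl fun l _ => ?_
    congr 2
    funext i
    by_cases hi : i = l
    · subst hi
      simp only [Function.update_self]
      exact hdual (φ i)
    · simp [Function.update_of_ne hi]

/-- Pointwise form of `Ad`-equivariance: `ρ(g X g⁻¹) (g · s) = g · (ρ(X) s)`. [folklore] -/
theorem tensorDerivation_conj_apply {a b : ℕ} (g : W ≃ₗ[K] W) (X : Module.End K W)
    (s : hodgeTensorSpaceOver K W a b) :
    tensorDerivation a b ((g : W →ₗ[K] W) ∘ₗ X ∘ₗ (g.symm : W →ₗ[K] W))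
        (tensorSpaceActOver g s) =
      tensorSpaceActOver g (tensorDerivation a b X s) := by
  have := LinearMap.congr_fun (tensorDerivation_conj_comp (a := a) (b := b) g X) s
  simpa using this

/-- **The annihilator of a `g`-fixed tensor is `Ad(g)`-stable**: if `g · s = s` and `ρ(X) s = 0`
then `ρ(g X g⁻¹) s = 0`. [folklore] -/
theorem tensorDerivation_conj_apply_eq_zero {a b : ℕ} (g : W ≃ₗ[K] W) {X : Module.End K W}
    {s : hodgeTensorSpaceOver K W a b} (hg : tensorSpaceActOver g s = s)
    (hX : tensorDerivation a b X s = 0) :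
    tensorDerivation a b ((g : W →ₗ[K] W) ∘ₗ X ∘ₗ (g.symm : W →ₗ[K] W)) s = 0 := by
  conv_lhs => rw [← hg]
  rw [tensorDerivation_conj_apply, hX, map_zero]

/-! ### The exponential gadget: a "torus element" fixes what its Lie algebra kills -/

section Gadget

variable {S : Type w} [Fintype S] [DecidableEq S]

/-- **Simultaneously diagonal `k ∈ GL(W)` and `Y ∈ End(W)` with compatible eigenvalues.** Let
`k (e σ) = u σ • e σ` and `Y (e σ) = y σ • e σ` in a basis `e`, and assume that every additive
relation `Σₖ y (β k) - Σₗ y (γ l) = 0` forces `∏ₖ u (β k) · (∏ₗ u (γ l))⁻¹ = 1` (as for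
`u = exp ∘ y`). Then every tensor `s ∈ T^{a,b}_K W` killed by `ρ(Y)` is fixed by `k`: in the tensor
basis, `ρ(Y)` is diagonal with eigenvalue `Σ y(β) - Σ y(γ)` and `k` with eigenvalue
`∏ u(β) (∏ u(γ))⁻¹`, and `s` only involves indices with `ρ(Y)`-eigenvalue `0` (Borel, *Linear
Algebraic Groups*, §8.2 and §7.3: the torus through a semisimple element fixes the tensors its Lie
algebra annihilates — here as pure linear algebra, with no algebraic group). [folklore] -/
theorem tensorSpaceActOver_eq_self_of_tensorDerivation_eq_zero (e : Module.Basis S K W) {a b : ℕ}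
    {k : W ≃ₗ[K] W} {Y : Module.End K W} {u y : S → K} (hk : ∀ σ, k (e σ) = u σ • e σ)
    (hY : ∀ σ, Y (e σ) = y σ • e σ)
    (hcompat : ∀ x : (Fin a → S) × (Fin b → S),
      (∑ i, y (x.1 i)) - ∑ j, y (x.2 j) = 0 → (∏ i, u (x.1 i)) * (∏ j, u (x.2 j))⁻¹ = 1)
    {s : hodgeTensorSpaceOver K W a b} (hs : tensorDerivation a b Y s = 0) :
    tensorSpaceActOver k s = s := by
  set B := hodgeTensorBasis e a b
  have hDY : ∀ x, tensorDerivation a b Y (B x) = ((∑ i, y (x.1 i)) - ∑ j, y (x.2 j)) • B x :=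
    fun x => tensorDerivation_hodgeTensorBasis' e hY x
  have hk' : ∀ x, (tensorSpaceActOver (a := a) (b := b) k).toLinearMap (B x) =
      ((∏ i, u (x.1 i)) * (∏ j, u (x.2 j))⁻¹) • B x :=
    fun x => tensorSpaceActOver_hodgeTensorBasis' e hk x
  apply B.repr.injective
  ext x
  have h0 : ((∑ i, y (x.1 i)) - ∑ j, y (x.2 j)) * B.repr s x = 0 := by
    rw [← basisRepr_apply_of_diag B hDY s x, hs, map_zero, Finsupp.zero_apply]
  change B.repr ((tensorSpaceActOver (a := a) (b := b) k).toLinearMap s) x = B.repr s x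
  rw [basisRepr_apply_of_diag B hk' s x]
  rcases mul_eq_zero.1 h0 with h | h
  · rw [hcompat x h, one_mul]
  · rw [h, mul_zero]

end Gadget

end Literature.AlgebraicGeometry.Motives

end
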